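import Summits.CriticalPhenomena.CardyFormulaZ2.Theses.CardyUniqueLimit
import Literature.Probability.Percolation.BoxCrossingJordan

/-!
# Refutation of `CardyUniqueLimit.NegDegenerateArcs` (stmt-CriticalPhenomena-0748)

The route's rank-6 *refutation guard* asks whether some conformal rectangle `R` has bond-`ℤ²`
crossing probability `bondDomainCrossingProb R δ = 0` for arbitrarily small mesh `δ` (an empty
discrete arc of the G02 discretisation `discreteArc`/`meshDomain` for a wild Jordan boundary),
which would make `CardyFormulaZ2` false as typed. It is false for EVERY `R`: the tree now proves
the RSW corollary `Literature.Probability.Percolation.discreteCrossingProb_clusterPt_mem_Ioo`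
(`discreteCrossingProb_clusterPt_mem_Ioo_holds`, file `Literature/Probability/Percolation/BoxCrossingJordan.lean`:
RSW at `p = 1/2`, FKG/duality chaining near the arcs, and the bulk property of the
largest-component discretisation for every Jordan domain, boundaries of positive area included),
so every cluster point of `δ ↦ bondDomainCrossingProb R δ` at `0⁺` lies in `(0, 1)`; but
`∃ᶠ δ in 𝓝[>] 0, bondDomainCrossingProb R δ = 0` says precisely that `0` is such a cluster point
(`Filter.mapClusterPt_iff_frequently`). The conditional form of this argument was attached to the
item as evidence by grounder g9-7 (2026-08-14) when the RSW corollary was still an unproved fact.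
-/

namespace Summit.CriticalPhenomena.CardyFormulaZ2.Theorems

open Filter Topology
open Literature.Probability.Percolation Literature.Probability.RandomPlanarGeometry

/-- **Record of the replaced/dropped route item `NegDegenerateArcs`** = stmt-CriticalPhenomena-0748 (ledger signature verbatim;
NOT a route item): after `CardyUniqueLimitNegDegenerateArcs_refuted` below closed the item `refuted` at 4517316a9261, the route
repair (`restate` with a new name, or `drop`) removed this constant from the gate-written Theses
file, while the Theorems file — append-only, statement text fixed — still names it ("Unknown
identifier" in the full builds of 2026-08-16). Re-declared here under its original fully-qualified
name and definiens solely so that this record keeps elaborating. FALSE (see the refutation below). -/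
def _root_.Summit.CriticalPhenomena.CardyFormulaZ2.Theses.CardyUniqueLimit.NegDegenerateArcs : Prop :=
  ∃ R : Literature.Probability.RandomPlanarGeometry.ConformalRectangle, ∃ᶠ δ in nhdsWithin (0:ℝ) (Set.Ioi 0), Literature.Probability.Percolation.bondDomainCrossingProb R δ = 0

/-- Refutes `CardyUniqueLimit.NegDegenerateArcs` (stmt-CriticalPhenomena-0748) [refuted-substantive]:
no conformal rectangle has bond-`ℤ²` crossing probability `0` frequently as `δ → 0⁺`, because
every cluster point at `0⁺` of `δ ↦ bondDomainCrossingProb R δ` lies in `(0,1)`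
(`discreteCrossingProb_clusterPt_mem_Ioo_holds`, RSW + FKG + bulk property of the discretisation,
Grimmett 1999 §11.7 Thm (11.70)), while "frequently `= 0`" makes `0` a cluster point. Witness: none
needed (the statement is `∃ R, …` and fails for all `R`). No repair: the item is the planner's
refutation GUARD, intended to be false — its refutation certifies that the conjunct
`CardyFormulaZ2` is not junk-refutable through degenerate discrete arcs; planner action =
`route edit --drop NegDegenerateArcs` (not load-bearing: `closes` uses only X_U and CardyRigidity).
[folklore] -/
theorem CardyUniqueLimitNegDegenerateArcs_refuted :
    ¬ Summit.CriticalPhenomena.CardyFormulaZ2.Theses.CardyUniqueLimit.NegDegenerateArcs := by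
  rintro ⟨R, hR⟩
  -- `0` is a cluster point of the crossing probabilities at `0⁺`
  have h0 : MapClusterPt (0 : ℝ) (𝓝[>] (0 : ℝ))
      (fun δ => discreteCrossingProb half R.carrier δ (R.arc 0) (R.arc 2)) := by
    rw [mapClusterPt_iff_frequently]
    intro s hs
    refine hR.mono fun δ hδ => ?_
    change bondDomainCrossingProb R δ = 0 at hδ
    show discreteCrossingProb half R.carrier δ (R.arc 0) (R.arc 2) ∈ s
    have : bondDomainCrossingProb R δ ∈ s := by rw [hδ]; exact mem_of_mem_nhds hs
    exact this
  -- but every cluster point lies in `(0, 1)`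
  have hmem := discreteCrossingProb_clusterPt_mem_Ioo_holds R h0
  exact lt_irrefl (0 : ℝ) hmem.1

end Summit.CriticalPhenomena.CardyFormulaZ2.Theorems
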